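import Summits.QuantumAdvantage.QuantumAdvantage.Theses.OddPrimeWalk
import Summits.QuantumAdvantage.AdviceFreeQNC0.WalkHardFShots
import HarnessLib

/-!
# Route OddPrimeWalk, CRUX `ShotsOdd` (stmt-QuantumAdvantage-22728, rank 4): the per-input-sparse rung for every prime `p ≥ 5`

The route's crux `ShotsOdd` — `∀ p ≥ 5 prime`: strategies of `𝔽_p`-degree `(log₂ n)^C` firing AT MOST `B` cuts on every input
(positions arbitrary and adaptive, potential support dense), `B³(log₂ n)^{2C+2} ≤ n`, win α's u-walk game `ringWinU` on at most
`θ·2ⁿ` inputs, one `θ < 1` for all `C` — is the tree theorem `Summit.QuantumAdvantage.AdviceFreeQNC0.walkHardFShots (p) (hp3 : p ≠ 3)`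
(`AdviceFreeQNC0/WalkHardFShots.lean`: quiet-interval surgery + the cut-free fibre argument with the sparse pattern-degree lemma,
over qn-prover g10's `elimLevelSqrtF`) at `p ≥ 5`; the item's body and `WalkHardFShots p` agree verbatim.
WHAT THIS IS NOT: the dense residual `DenseResidualOdd` (crux rank 2) is open; separation NOT moved by this item alone.
-/

set_option linter.dupNamespace false

namespace Summit.QuantumAdvantage.QuantumAdvantage.Theorems

/-- **Crux `ShotsOdd` — PROVED**: `∀ p ≥ 5 prime, WalkHardFShots p` (one line over `AdviceFreeQNC0.walkHardFShots`). -/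
theorem oddPrimeWalk_shotsOdd : Summit.QuantumAdvantage.QuantumAdvantage.Theses.OddPrimeWalk.ShotsOdd :=
  fun p _ hp => Summit.QuantumAdvantage.AdviceFreeQNC0.walkHardFShots p (by omega)

end Summit.QuantumAdvantage.QuantumAdvantage.Theorems
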